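import Mathlib
import HarnessLib
import Summits.Ventures.LatticeQCDFlow.Scoring.TwoCodeAgreementInProbability

/-!
# ASYMPTOTIC COVERAGE made explicit: a statistic converging in distribution to a law without
# atoms has `P(Tₙ ∈ [a, b]) → P(Z ∈ [a, b])`; for a standard normal limit,
# `P(|Tₙ| ≤ z) → N(0,1)([−z, z])` — the nominal coverage of every "within `z·σ`" criterion

HONEST FRAMING: exact (Metropolis-corrected) sampling algorithms for lattice gauge theory;
figures of merit are autocorrelation/cost numbers at stated couplings and volumes; no
continuum-physics claim.

Venture `LatticeQCDFlow` (cell pub-lqcd), topic `Scoring`; FANOUT row 4 (`s0-u1-b`, rung S0-B: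
acceptance criterion "A vs B within `1σ_comb`").  The packet's studentised central limit
theorems conclude `Tₙ ⇒ Z ∼ N(0, 1)`; the sentence the agreement table needs is about
PROBABILITIES OF INTERVALS: `P(|Tₙ| ≤ z) → P(|Z| ≤ z)`.  That is one implication of the
portmanteau theorem for continuity sets (Mathlib's
`ProbabilityMeasure.tendsto_measure_of_null_frontier_of_tendsto'`), applicable because a
Gaussian law has no atoms (`nullSingletonClass_gaussianReal`), so the two-point frontier of an
interval is null.  This file packages it for real statistics
(**`tendsto_measure_preimage_of_tendstoInDistribution`**, any Borel continuity set;
**`tendsto_measureReal_abs_le_of_tendstoInDistribution`**, atomless limit;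
**`tendsto_measureReal_abs_le_gaussian`**, standard normal limit) and reads off the coverage
of the two-code agreement criterion with unequal sample sizes and in-probability error bars
(**`twoSample_agreement_coverage`**: `P(|T| ≤ z) → N(0,1)([−z, z])`, e.g. `≈ 0.683` at `z = 1`,
the number itself not evaluated here).  NEW WORK of the cell; no definition; nothing cited as
a fact.

## Content

* `tendsto_measure_preimage_of_tendstoInDistribution`, `tendsto_measureReal_preimage_of_…`;
* `tendsto_measureReal_abs_le_of_tendstoInDistribution`, `tendsto_measureReal_abs_le_gaussian`;
* **`twoSample_agreement_coverage`**.

NOT CLAIMED: the numerical value of `N(0,1)([−1, 1])`; rates of convergence of the coverage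
(Berry–Esseen); one-sided or data-dependent `z`.
-/

noncomputable section

namespace Summit.Ventures.LatticeQCDFlow.Scoring.CardConsistency

open MeasureTheory ProbabilityTheory Filter
open scoped Topology

/-! ## §1 Continuity sets -/

section ContinuitySets

variable {Ω : Type*} [MeasurableSpace Ω] {P : Measure Ω} [IsProbabilityMeasure P]
variable {Ω' : Type*} [MeasurableSpace Ω'] {P' : Measure Ω'} [IsProbabilityMeasure P']

/-- **Portmanteau, continuity sets, for statistics**: `Tₙ ⇒ Z`, `E` Borel with
`P(Z ∈ ∂E) = 0` ⇒ `P(Tₙ ∈ E) → P(Z ∈ E)`. [ours] (Mathlib's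
`ProbabilityMeasure.tendsto_measure_of_null_frontier_of_tendsto'`) -/
theorem tendsto_measure_preimage_of_tendstoInDistribution {T : ℕ → Ω → ℝ} {Z : Ω' → ℝ}
    (h : TendstoInDistribution T atTop Z (fun _ => P) P') {E : Set ℝ} (hE : MeasurableSet E)
    (hfr : (P'.map Z) (frontier E) = 0) :
    Tendsto (fun n => P (T n ⁻¹' E)) atTop (𝓝 (P' (Z ⁻¹' E))) := by
  have key := ProbabilityMeasure.tendsto_measure_of_null_frontier_of_tendsto' h.tendsto (E := E)
    (by simpa only [ProbabilityMeasure.coe_mk] using hfr)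
  simp only [ProbabilityMeasure.coe_mk] at key
  rw [Measure.map_apply_of_aemeasurable h.aemeasurable_limit hE] at key
  refine key.congr fun n => ?_
  rw [Measure.map_apply_of_aemeasurable (h.forall_aemeasurable n) hE]

/-- The same in real-valued probabilities. [ours] -/
theorem tendsto_measureReal_preimage_of_tendstoInDistribution {T : ℕ → Ω → ℝ} {Z : Ω' → ℝ}
    (h : TendstoInDistribution T atTop Z (fun _ => P) P') {E : Set ℝ} (hE : MeasurableSet E)
    (hfr : (P'.map Z) (frontier E) = 0) :
    Tendsto (fun n => P.real (T n ⁻¹' E)) atTop (𝓝 (P'.real (Z ⁻¹' E))) := by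
  have key := tendsto_measure_preimage_of_tendstoInDistribution h hE hfr
  simp only [measureReal_def]
  exact (ENNReal.tendsto_toReal (measure_ne_top P' _)).comp key

/-- **Intervals are continuity sets of an atomless limit**: `Tₙ ⇒ Z` with `P ∘ Z⁻¹` without
atoms ⇒ `P(|Tₙ| ≤ z) → P(|Z| ≤ z)`. [ours] -/
theorem tendsto_measureReal_abs_le_of_tendstoInDistribution {T : ℕ → Ω → ℝ} {Z : Ω' → ℝ}
    (h : TendstoInDistribution T atTop Z (fun _ => P) P') [NullSingletonClass (P'.map Z)]
    (z : ℝ) :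
    Tendsto (fun n => P.real {ω | |T n ω| ≤ z}) atTop (𝓝 (P'.real {ω' | |Z ω'| ≤ z})) := by
  have hfr : (P'.map Z) (frontier (Set.Icc (-z) z)) = 0 := by
    refine Set.Countable.measure_zero ?_ _
    by_cases hz : -z ≤ z
    · rw [frontier_Icc hz]
      exact (Set.toFinite _).countable
    · rw [Set.Icc_eq_empty hz, frontier_empty]
      exact Set.countable_empty
  have key := tendsto_measureReal_preimage_of_tendstoInDistribution h measurableSet_Icc hfr
  have e1 : ∀ n, T n ⁻¹' Set.Icc (-z) z = {ω | |T n ω| ≤ z} := fun n => by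
    ext ω
    simp [abs_le]
  have e2 : Z ⁻¹' Set.Icc (-z) z = {ω' | |Z ω'| ≤ z} := by
    ext ω'
    simp [abs_le]
  simpa only [e1, e2] using key

/-- **Standard normal limit**: `Tₙ ⇒ Z ∼ N(0, 1)` ⇒ `P(|Tₙ| ≤ z) → N(0,1)([−z, z])`. [ours] -/
theorem tendsto_measureReal_abs_le_gaussian {T : ℕ → Ω → ℝ} {Z : Ω' → ℝ}
    (h : TendstoInDistribution T atTop Z (fun _ => P) P') (hZ : HasLaw Z (gaussianReal 0 1) P')
    (z : ℝ) :
    Tendsto (fun n => P.real {ω | |T n ω| ≤ z}) atTop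
      (𝓝 ((gaussianReal 0 1).real (Set.Icc (-z) z))) := by
  haveI : NullSingletonClass (P'.map Z) := by
    rw [hZ.map_eq]
    exact nullSingletonClass_gaussianReal one_ne_zero
  have key := tendsto_measureReal_abs_le_of_tendstoInDistribution h z
  have e : P'.real {ω' | |Z ω'| ≤ z} = (gaussianReal 0 1).real (Set.Icc (-z) z) := by
    rw [← hZ.map_eq, measureReal_def, measureReal_def,
      Measure.map_apply_of_aemeasurable hZ.aemeasurable measurableSet_Icc]
    congr 1
    congr 1
    ext ω'
    simp [abs_le]
  rw [e] at key
  exact key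

end ContinuitySets

/-! ## §2 The coverage of the two-code agreement criterion -/

section Coverage

variable {ΩA : Type*} [MeasurableSpace ΩA] {PA : Measure ΩA} [IsProbabilityMeasure PA]
variable {ΩB : Type*} [MeasurableSpace ΩB] {PB : Measure ΩB} [IsProbabilityMeasure PB]
variable {Ω' : Type*} [MeasurableSpace Ω'] {P' : Measure Ω'} [IsProbabilityMeasure P']

/-- **"A VS B WITHIN `z·σ_comb`" HAS ASYMPTOTICALLY ITS NOMINAL COVERAGE.**  In the setting of
`twoSample_agreement_clt_of_tendstoInMeasure` (two independent codes with one-code central limit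
theorems of positive variances, error bars consistent in probability, code `B` read along any
`mₙ → ∞`), for every `z`:
`(P_A ⊗ P_B)(|Sₙ^A − S_{mₙ}^B| ≤ z·√(V̂ₙ^A + V̂_{mₙ}^B)) → N(0,1)([−z, z])` — stated for the
studentised statistic `|T| ≤ z`. [ours] -/
theorem twoSample_agreement_coverage {SA VA : ℕ → ΩA → ℝ} {SB VB : ℕ → ΩB → ℝ}
    {a sA sB : ℝ} {ZA ZB Z : Ω' → ℝ} (hsA : 0 < sA) (hsB : 0 < sB)
    (hSAm : ∀ n, Measurable (SA n)) (hVAm : ∀ n, Measurable (VA n))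
    (hSBm : ∀ n, Measurable (SB n)) (hVBm : ∀ n, Measurable (VB n))
    (hcltA : TendstoInDistribution (fun (n : ℕ) ω => Real.sqrt n * (SA n ω - a)) atTop ZA
      (fun _ => PA) P') (hZA : HasLaw ZA (gaussianReal 0 sA.toNNReal) P')
    (hcltB : TendstoInDistribution (fun (n : ℕ) ω => Real.sqrt n * (SB n ω - a)) atTop ZB
      (fun _ => PB) P') (hZB : HasLaw ZB (gaussianReal 0 sB.toNNReal) P')
    (hVA : TendstoInMeasure PA (fun (n : ℕ) ω => (n : ℝ) * VA n ω) atTop fun _ => sA)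
    (hVB : TendstoInMeasure PB (fun (n : ℕ) ω => (n : ℝ) * VB n ω) atTop fun _ => sB)
    {m : ℕ → ℕ} (hm : Tendsto m atTop atTop) (hZ : HasLaw Z (gaussianReal 0 1) P') (z : ℝ) :
    Tendsto (fun n => (PA.prod PB).real {ω : ΩA × ΩB |
        |(SA n ω.1 - SB (m n) ω.2) / Real.sqrt (VA n ω.1 + VB (m n) ω.2)| ≤ z}) atTop
      (𝓝 ((gaussianReal 0 1).real (Set.Icc (-z) z))) :=
  tendsto_measureReal_abs_le_gaussian
    (twoSample_agreement_clt_of_tendstoInMeasure hsA hsB hSAm hVAm hSBm hVBm hcltA hZA hcltB hZB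
      hVA hVB hm hZ) hZ z

end Coverage

end Summit.Ventures.LatticeQCDFlow.Scoring.CardConsistency

end
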